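import Literature.NumberTheory.LFunctions.Zhang2022.Section10Lemma101ShortMeans
import HarnessLib

/-!
# Zhang (2022), rescue GAP/BED (D-0124 (3)(4)): Lemma 10.1, SHORT Riesz means (`X ≤ T`) under the minimum premise
# `‖L(1,χ)‖ ≤ 𝓛⁻¹⁵` — in fact the short range consumes (A) only as `‖L(1,χ)‖ ≤ 𝓛^{−1.1}` (node group 2: §10 → (10.17))

Topic `Literature/NumberTheory/LFunctions/Zhang2022` (Landau–Siegel audit tree; verdict-neutral).
Y. Zhang, *Discrete mean estimates and the Landau–Siegel zero*, arXiv:2211.02515v1 (2022)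
[Zhang2022LandauSiegel] — **an unrefereed manuscript under adjudication; nothing in this file asserts or
denies its Theorems 1–2, and nothing here is a claim about Landau–Siegel zeros. The programme SEARCHES and
TYPES; no claim about Landau–Siegel zeros, Theorems 1–2 of arXiv:2211.02515 or a repaired Margin232 until a
kernel theorem says so.**

Lemma 10.1 (§10 pp. 19–20; node `Skeleton.Lemma101 c′`, cone C24 of `Skeleton.theorem1_of_leaves`; tree theorem
`Lemma101.lemma101_holds` under the printed Assumption (A)). Its proof in the tree consumes (A) in two places only: the
short Riesz means `‖Σ_{m≤X} χ(m)m^{−1−δ}log(X/m)‖ ≤ (5 + 4Kπ)𝓛²` for `X ≤ T` (`Lemma101.norm_riesz_short_le`, where (A) enters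
as `𝓛^{1.1}‖L(1,χ)‖ ≤ 𝓛²·𝓛⁻²⁰²² ≤ 1`, i.e. ANY `‖L(1,χ)‖ ≤ 𝓛^{−1.1}` would do) and the long means `T ≤ X ≤ P` through the
Lemma 8.2 core `Lemma82.sum_twist_log_sub_main_le` (minimum-premise twin `Repair.Gap.sum_twist_log_sub_main_le_pow15`, p566965,
itself fed by the Lemma 5.8 door). This file is the first of three (`…ShortPremise` / `…RangesPremise` / `…Lemma101Premise`)
re-running Lemma 10.1 VERBATIM under `‖L(1,χ)‖ ≤ 𝓛⁻¹⁵`: here `norm_riesz_short_le_pow15` (tree proof verbatim, the one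
line `𝓛² · 𝓛⁻²⁰²²` ↦ `𝓛² · 𝓛⁻¹⁵`; the tree-private `norm_riesz_head_le` is repeated privately). GAP G-31 context only.
Theorems only; no definition, no named fact; nothing about (A) itself.

## References

* Y. Zhang, arXiv:2211.02515v1 (2022), §10 Lemma 10.1 (proof, pp. 19–20). [cite: Zhang2022LandauSiegel, §10 Lemma 10.1]
* H. L. Montgomery, R. C. Vaughan, *Multiplicative Number Theory I*, CUP 2007, §9.4. [cite: MontgomeryVaughan2007, §9.4 Thm. 9.18]
-/

noncomputable section

open Complex Real

namespace Literature.NumberTheory.LFunctions.Zhang2022.Lemma101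

open Literature.NumberTheory.LFunctions.Zhang2022.Skeleton
open Literature.NumberTheory.LFunctions.Zhang2022.Lemma82 (twist C82)

variable {D : ℕ} (χ : DirichletCharacter ℂ D)

/-- The head `m ≤ D` of the short Riesz mean (tree-private `Lemma101.norm_riesz_head_le`, repeated privately).
[cite: Zhang2022LandauSiegel, §10 proof of Lemma 10.1] -/
private theorem norm_riesz_head_le [NeZero D] (hD2 : 2 ≤ D) {δ : ℂ} (hδre : δ.re = 0) {X : ℝ}
    (hX1 : 1 ≤ X) :
    ‖∑ m ∈ Finset.Ioc 0 D, twist χ δ m * (Real.log (X / m) : ℂ)‖ ≤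
      Real.log X * ‖∑ m ∈ Finset.Ioc 0 D, twist χ δ m‖ +
        Real.log D * (1 + Real.log D) := by
  set L : ℝ := Real.log D with hLdef
  have hX0 : 0 < X := by linarith
  have hlogX0 : 0 ≤ Real.log X := Real.log_nonneg hX1
  have hsplit : ∑ m ∈ Finset.Ioc 0 D, twist χ δ m * (Real.log (X / m) : ℂ) =
      (∑ m ∈ Finset.Ioc 0 D, twist χ δ m) * (Real.log X : ℂ) -
        ∑ m ∈ Finset.Ioc 0 D, twist χ δ m * (Real.log m : ℂ) := by
    rw [Finset.sum_mul, ← Finset.sum_sub_distrib]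
    refine Finset.sum_congr rfl fun m hm => ?_
    rw [Finset.mem_Ioc] at hm
    have hm0 : (0 : ℝ) < m := by exact_mod_cast hm.1
    rw [Real.log_div hX0.ne' hm0.ne']
    push_cast
    ring
  have h1a : ‖∑ m ∈ Finset.Ioc 0 D, twist χ δ m * (Real.log m : ℂ)‖ ≤ L * (1 + L) := by
    calc ‖∑ m ∈ Finset.Ioc 0 D, twist χ δ m * (Real.log m : ℂ)‖
        ≤ ∑ m ∈ Finset.Ioc 0 D, ‖twist χ δ m * (Real.log m : ℂ)‖ := norm_sum_le _ _
      _ ≤ ∑ m ∈ Finset.Ioc 0 D, (m : ℝ)⁻¹ * L := by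
          refine Finset.sum_le_sum fun m hm => ?_
          rw [Finset.mem_Ioc] at hm
          have hm0 : (0 : ℝ) < m := by exact_mod_cast hm.1
          have hlm0 : 0 ≤ Real.log m := Real.log_nonneg (by exact_mod_cast hm.1)
          have hlmL : Real.log m ≤ L := Real.log_le_log hm0 (by exact_mod_cast hm.2)
          rw [norm_mul, Complex.norm_real, Real.norm_of_nonneg hlm0]
          exact mul_le_mul (norm_twist_le χ hδre hm.1) hlmL hlm0 (by positivity)
      _ = (∑ m ∈ Finset.Ioc 0 D, (m : ℝ)⁻¹) * L := by rw [Finset.sum_mul]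
      _ ≤ (1 + L) * L := by
          have hL0 : 0 ≤ L := Real.log_nonneg (by exact_mod_cast (by omega : 1 ≤ D))
          exact mul_le_mul_of_nonneg_right (sum_Ioc_inv_le D) hL0
      _ = L * (1 + L) := by ring
  rw [hsplit]
  calc ‖(∑ m ∈ Finset.Ioc 0 D, twist χ δ m) * (Real.log X : ℂ) -
        ∑ m ∈ Finset.Ioc 0 D, twist χ δ m * (Real.log m : ℂ)‖
      ≤ ‖(∑ m ∈ Finset.Ioc 0 D, twist χ δ m) * (Real.log X : ℂ)‖ +
          ‖∑ m ∈ Finset.Ioc 0 D, twist χ δ m * (Real.log m : ℂ)‖ := norm_sub_le _ _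
    _ ≤ Real.log X * ‖∑ m ∈ Finset.Ioc 0 D, twist χ δ m‖ + L * (1 + L) := by
        refine add_le_add (le_of_eq ?_) h1a
        rw [norm_mul, Complex.norm_real, Real.norm_of_nonneg hlogX0, mul_comm]

/-- **Short Riesz logarithmic means under the minimum premise** (twin of `Lemma101.norm_riesz_short_le`, same bound
`(5 + 4Kπ)𝓛²`): `χ` primitive, `𝓛 ≥ 200 + Kπ`, `‖L(1,χ)‖ ≤ 𝓛⁻¹⁵`, `δ` purely imaginary with `‖δ‖ ≤ Kπ𝓛⁻⁹`, `0 < X ≤ T`.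
The only use of the premise is `𝓛^{1.1}‖L(1,χ)‖ ≤ 𝓛²𝓛⁻¹⁵ ≤ 1`. [cite: Zhang2022LandauSiegel, §10 proof of Lemma 10.1] -/
theorem norm_riesz_short_le_pow15 [NeZero D] (hprim : χ.IsPrimitive) {K : ℝ} (hK0 : 0 ≤ K)
    (hL : 200 + K * π ≤ Real.log D) (h15 : ‖χ.LFunction 1‖ ≤ 1 / Real.log D ^ 15)
    {δ : ℂ} (hδre : δ.re = 0) (hδ : ‖δ‖ ≤ K * π / Real.log D ^ 9)
    {X : ℝ} (hX0 : 0 < X) (hXT : X ≤ Real.exp (Real.log D ^ (11 / 10 : ℝ))) :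
    ‖∑ m ∈ Finset.Ioc 0 ⌊X⌋₊, twist χ δ m * (Real.log (X / m) : ℂ)‖ ≤
      (5 + 4 * K * π) * Real.log D ^ 2 := by
  obtain ⟨hD2, hL200, hDexp, hsqrt, hKπL⟩ := basics_of_large (D := D) hK0 hL
  have hπ := Real.pi_pos
  set L : ℝ := Real.log D with hLdef
  set N : ℕ := ⌊X⌋₊ with hNdef
  have hL1 : 1 ≤ L := by linarith
  have hL0 : 0 < L := by linarith
  have hKπ : 0 ≤ K * π := by positivity
  have hD0 : (0 : ℝ) < D := by exact_mod_cast (by omega : 0 < D)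
  -- sizes
  have hL11 : L ^ (11 / 10 : ℝ) ≤ L ^ 2 := by
    calc L ^ (11 / 10 : ℝ) ≤ L ^ ((2 : ℕ) : ℝ) :=
          Real.rpow_le_rpow_of_exponent_le hL1 (by norm_num)
      _ = L ^ 2 := Real.rpow_natCast L 2
  have hL11one : 1 ≤ L ^ (11 / 10 : ℝ) := Real.one_le_rpow hL1 (by norm_num)
  have hlogX : Real.log X ≤ L ^ (11 / 10 : ℝ) := by
    calc Real.log X ≤ Real.log (Real.exp (L ^ (11 / 10 : ℝ))) := Real.log_le_log hX0 hXT
      _ = L ^ (11 / 10 : ℝ) := Real.log_exp _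
  have hL8 : L ≤ L ^ 8 := by
    calc L = L ^ 1 := (pow_one L).symm
      _ ≤ L ^ 8 := pow_le_pow_right₀ hL1 (by norm_num)
  have hδL : ‖δ‖ * L ≤ 1 := by
    calc ‖δ‖ * L ≤ K * π / L ^ 9 * L := mul_le_mul_of_nonneg_right hδ hL0.le
      _ = K * π / L ^ 8 := by field_simp
      _ ≤ 1 := by
          rw [div_le_one (by positivity)]
          exact hKπL.trans hL8
  have hδone : ‖δ‖ ≤ 1 := by
    calc ‖δ‖ = ‖δ‖ * 1 := (mul_one _).symm
      _ ≤ ‖δ‖ * L := mul_le_mul_of_nonneg_left hL1 (norm_nonneg _)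
      _ ≤ 1 := hδL
  have hNX : (N : ℝ) ≤ X := Nat.floor_le hX0.le
  have hXN : X < N + 1 := Nat.lt_floor_add_one X
  by_cases hN0 : N = 0
  · rw [hN0, Finset.Ioc_self, Finset.sum_empty, norm_zero]; positivity
  have hX1 : 1 ≤ X := Nat.floor_pos.mp (Nat.pos_of_ne_zero hN0)
  have hlogX0 : 0 ≤ Real.log X := Real.log_nonneg hX1
  by_cases hND : N ≤ D
  · -- Case A: `X < D + 1`, everything trivial
    have hlogX' : Real.log X ≤ 1 + L := by
      have h2D : X ≤ 2 * D := by
        have h1 : (N : ℝ) ≤ D := by exact_mod_cast hND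
        have h2 : (2 : ℝ) ≤ D := by exact_mod_cast hD2
        linarith
      calc Real.log X ≤ Real.log (2 * D) := Real.log_le_log hX0 h2D
        _ = Real.log 2 + L := by rw [Real.log_mul (by norm_num) hD0.ne']
        _ ≤ 1 + L := by linarith [Real.log_two_lt_d9]
    have hlogN : Real.log N ≤ L :=
      Real.log_le_log (by exact_mod_cast Nat.pos_of_ne_zero hN0) (by exact_mod_cast hND)
    calc ‖∑ m ∈ Finset.Ioc 0 N, twist χ δ m * (Real.log (X / m) : ℂ)‖
        ≤ ∑ m ∈ Finset.Ioc 0 N, ‖twist χ δ m * (Real.log (X / m) : ℂ)‖ := norm_sum_le _ _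
      _ ≤ ∑ m ∈ Finset.Ioc 0 N, (m : ℝ)⁻¹ * Real.log X := by
          refine Finset.sum_le_sum fun m hm => ?_
          rw [Finset.mem_Ioc] at hm
          have hm0 : (0 : ℝ) < m := by exact_mod_cast hm.1
          have hm1 : (1 : ℝ) ≤ m := by exact_mod_cast hm.1
          have hmX : (m : ℝ) ≤ X := (Nat.cast_le.mpr hm.2).trans hNX
          have hl0 : 0 ≤ Real.log (X / m) := Real.log_nonneg ((one_le_div hm0).mpr hmX)
          have hl1 : Real.log (X / m) ≤ Real.log X := by
            rw [Real.log_div hX0.ne' hm0.ne']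
            linarith [Real.log_nonneg hm1]
          rw [norm_mul, Complex.norm_real, Real.norm_of_nonneg hl0]
          exact mul_le_mul (norm_twist_le χ hδre hm.1) hl1 hl0 (by positivity)
      _ = (∑ m ∈ Finset.Ioc 0 N, (m : ℝ)⁻¹) * Real.log X := by rw [Finset.sum_mul]
      _ ≤ (1 + L) * (1 + L) :=
          mul_le_mul ((sum_Ioc_inv_le N).trans (by linarith)) hlogX' hlogX0 (by linarith)
      _ ≤ (5 + 4 * K * π) * L ^ 2 := by nlinarith
  · -- Case B: `D < N ≤ X ≤ T`: split at `m = D`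
    have hDN : D < N := not_le.mp hND
    set W : ℝ := Real.sqrt D * (1 + Real.log D) with hWdef
    have hWexp : W = Real.exp (L / 2) * (1 + L) := by rw [hWdef, hsqrt]
    have hsix := six_mul_sq_mul_le_exp_half hL200
    have hsq : Real.exp (L / 2) * Real.exp (L / 2) = D := by
      rw [← Real.exp_add, add_halves, ← hDexp]
    rw [← Finset.sum_Ioc_consecutive _ (Nat.zero_le D) hDN.le]
    -- Part 1
    have hB := norm_twist_partial_sum_le χ hprim hD2 hδL
    have hhead := norm_riesz_head_le χ hD2 hδre hX1
    have h1b : Real.log X * ‖∑ m ∈ Finset.Ioc 0 D, twist χ δ m‖ ≤ 2 + 4 * K * π := by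
      have hi : L ^ (11 / 10 : ℝ) * ‖χ.LFunction 1‖ ≤ 1 := by
        calc L ^ (11 / 10 : ℝ) * ‖χ.LFunction 1‖ ≤ L ^ 2 * (1 / L ^ 15) :=
              mul_le_mul hL11 h15 (norm_nonneg _) (by positivity)
          _ = L ^ 2 / L ^ 15 := by rw [mul_one_div]
          _ ≤ 1 := by
              rw [div_le_one (by positivity)]
              exact pow_le_pow_right₀ hL1 (by norm_num)
      have hii : L ^ (11 / 10 : ℝ) * (2 * (Real.sqrt D * (1 + L)) / ((D : ℝ) + 1)) ≤ 1 := by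
        have hD1 : (0 : ℝ) < (D : ℝ) + 1 := by positivity
        rw [← mul_div_assoc, div_le_one hD1, hsqrt]
        calc L ^ (11 / 10 : ℝ) * (2 * (Real.exp (L / 2) * (1 + L)))
            = (2 * L ^ (11 / 10 : ℝ) * (1 + L)) * Real.exp (L / 2) := by ring
          _ ≤ (6 * L ^ 2 * (1 + L)) * Real.exp (L / 2) := by
              refine mul_le_mul_of_nonneg_right ?_ (Real.exp_pos _).le
              nlinarith
          _ ≤ Real.exp (L / 2) * Real.exp (L / 2) :=
              mul_le_mul_of_nonneg_right hsix (Real.exp_pos _).le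
          _ = D := hsq
          _ ≤ D + 1 := by linarith
      have hiii : L ^ (11 / 10 : ℝ) * (2 * ‖δ‖ * L * (1 + L)) ≤ 4 * K * π := by
        calc L ^ (11 / 10 : ℝ) * (2 * ‖δ‖ * L * (1 + L))
            ≤ L ^ 2 * (2 * (K * π / L ^ 9) * L * (2 * L)) := by gcongr; linarith
          _ = 4 * K * π * (L ^ 4 / L ^ 9) := by field_simp; ring
          _ ≤ 4 * K * π * 1 := by
              refine mul_le_mul_of_nonneg_left ?_ (by positivity)
              rw [div_le_one (by positivity)]
              exact pow_le_pow_right₀ hL1 (by norm_num)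
          _ = 4 * K * π := mul_one _
      calc Real.log X * ‖∑ m ∈ Finset.Ioc 0 D, twist χ δ m‖
          ≤ L ^ (11 / 10 : ℝ) * (‖χ.LFunction 1‖ + 2 * (Real.sqrt D * (1 + L)) / ((D : ℝ) + 1) +
              2 * ‖δ‖ * L * (1 + L)) :=
            mul_le_mul hlogX hB (norm_nonneg _) (by positivity)
        _ = L ^ (11 / 10 : ℝ) * ‖χ.LFunction 1‖ +
              L ^ (11 / 10 : ℝ) * (2 * (Real.sqrt D * (1 + L)) / ((D : ℝ) + 1)) +
              L ^ (11 / 10 : ℝ) * (2 * ‖δ‖ * L * (1 + L)) := by ring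
        _ ≤ 1 + 1 + 4 * K * π := add_le_add (add_le_add hi hii) hiii
        _ = 2 + 4 * K * π := by ring
    have hP1 : ‖∑ m ∈ Finset.Ioc 0 D, twist χ δ m * (Real.log (X / m) : ℂ)‖ ≤
        (2 + 4 * K * π) + L * (1 + L) := hhead.trans (add_le_add h1b le_rfl)
    -- Part 2
    have htail := norm_riesz_tail_le χ hprim hD2 hδre hδone hX0 hlogX hL11one hD2 hDN
    have hP2 : ‖∑ m ∈ Finset.Ioc D N, twist χ δ m * (Real.log (X / m) : ℂ)‖ ≤ 1 := by
      refine htail.trans ?_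
      rw [div_le_one hD0, hsqrt]
      calc Real.exp (L / 2) * (1 + L) * (1 + 5 * L ^ (11 / 10 : ℝ))
          = ((1 + L) * (1 + 5 * L ^ (11 / 10 : ℝ))) * Real.exp (L / 2) := by ring
        _ ≤ (6 * L ^ 2 * (1 + L)) * Real.exp (L / 2) := by
            refine mul_le_mul_of_nonneg_right ?_ (Real.exp_pos _).le
            nlinarith
        _ ≤ Real.exp (L / 2) * Real.exp (L / 2) :=
            mul_le_mul_of_nonneg_right hsix (Real.exp_pos _).le
        _ = D := hsq
    calc ‖(∑ m ∈ Finset.Ioc 0 D, twist χ δ m * (Real.log (X / m) : ℂ)) +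
          ∑ m ∈ Finset.Ioc D N, twist χ δ m * (Real.log (X / m) : ℂ)‖
        ≤ ‖∑ m ∈ Finset.Ioc 0 D, twist χ δ m * (Real.log (X / m) : ℂ)‖ +
            ‖∑ m ∈ Finset.Ioc D N, twist χ δ m * (Real.log (X / m) : ℂ)‖ := norm_add_le _ _
      _ ≤ ((2 + 4 * K * π) + L * (1 + L)) + 1 := add_le_add hP1 hP2
      _ ≤ (5 + 4 * K * π) * L ^ 2 := by
          have hL1' : 0 ≤ L - 1 := by linarith
          have hpos : 0 ≤ (4 * L + 3) * (L - 1) + 4 * (K * π) * ((L - 1) * (L + 1)) :=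
            add_nonneg (mul_nonneg (by positivity) hL1')
              (mul_nonneg (by positivity) (mul_nonneg hL1' (by positivity)))
          have e : (5 + 4 * K * π) * L ^ 2 - (((2 + 4 * K * π) + L * (1 + L)) + 1) =
              (4 * L + 3) * (L - 1) + 4 * (K * π) * ((L - 1) * (L + 1)) := by ring
          linarith

end Literature.NumberTheory.LFunctions.Zhang2022.Lemma101
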